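import Summits.QuantumAdvantage.QuantumAdvantage.Theorems.NearExactIsExact.Negative.TypeOBoundaryPrepFourteen
import Summits.QuantumAdvantage.QuantumAdvantage.Theorems.NearExactIsExact.Negative.TypeOFourierCoreFourteen
import Summits.QuantumAdvantage.QuantumAdvantage.Theorems.NearExactIsExact.Negative.TypeTFalseFourteen
import Summits.QuantumAdvantage.QuantumAdvantage.Theorems.CubicForrelationNearExactIsExactSecondWeightAll

/-!
# The shape of a type-O side at `Φ = 121/128` on 14 bits (NearExactIsExact, disprover gen 25)

Negative/structural theorem for the crux `CubicForrelation.NearExactIsExact` (item r2), finite slice `n = 14`; the boundary case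
of THEOREM TypeO121 (`…Negative.TypeOOneTwentyOneFourteen`: a type-O side caps `Φ ≤ 121/128`).
HONEST FRAMING: value = THEOREM about cubic Boolean functions on 14 bits — NOT summit progress; no violation of
`NearExactIsExact`, no per-`n` value of `θ`, nothing about the asymptotic constant.

* `tb_E1024_false` (engine): cubic `f, g`, `g` of type O (`W_g = 32u`, `u` odd), budget `Σ(u − 4(−1)^f)² ≤ 28672` and digit set
  `E = {d₁ = d₂}` of exactly `2¹⁰` points ⇒ contradiction (periods of the minimum-weight word `1_E` ⇒ Pfaffian vanishing
  `pp_period_pf` via `to_mod_eight` ⇒ rank 2 dead by `fo_lowrank_false` / radical case: Fourier core `to_core`, six frequencies,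
  `ℓ¹` transport `Σ|F − F₀| ≤ 2048` ⇒ `|F̂| ≥ 6144` at six frequencies ⇒ partner costs `tb_partner_typeO`, `tb_partner_levelSix`,
  `fo_levelSeven`).
* `typeO_ge_121_shape` (THEOREM TypeO121-boundary): `121/128 ≤ Φ(f,g)` with `g` of type O ⇒ `#E = 1536` (second weight of
  `RM(4,14)`), the residual is tight (`(u − 4(−1)^f)² = 1 + 8·1_E` pointwise) and `Φ = 121/128`; `typeO_lt_121_of_card_ne`.
So the value `121/128` — IF it is a value of a cubic pair on 14 bits with a type-O side — comes only from this rigid configuration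
(the analogue one rung down of gen 24's configuration T at `61/64`, which was then shown impossible).

Sources: [this work]; F. J. MacWilliams, N. J. A. Sloane (1977) Ch. 13 §4, Ch. 15 §2 (weights of RM codes below twice the
minimum: Kasami–Tokura).  Standard axioms only.
-/

set_option linter.dupNamespace false -- D-0017: single-problem summit ⇒ `QuantumAdvantage.QuantumAdvantage` by design

noncomputable section

namespace Summit.QuantumAdvantage.QuantumAdvantage.Theorems.NearExactIsExact.Negative.TypeOBoundaryOneTwentyOneFourteen

open Finset
open Literature.Computability.QuantumComplexity
open Literature.Computability.QuantumComplexity.BuzetChailloux (bxor zeroVec bxor_bxor_cancel_left bxor_zeroVec zeroVec_bxor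
  bxor_comm bxor_self signOf_sq)
open Literature.Computability.QuantumComplexity.DerivativeWalsh (W dwt sum_W_sq twist_bxor_left sum_char_subspace W_mul_W_bxor)
open Summit.QuantumAdvantage.QuantumAdvantage.Theorems.CubicForrelation.NearExactIsExact
open Summit.QuantumAdvantage.QuantumAdvantage.Theorems.SignedCubicForrelationNotPrBPP.Negative.HalfQuad (forrelation_comm)
open Summit.QuantumAdvantage.QuantumAdvantage.Theorems.NearExactIsExact.Negative.CaseAFrameFreeFourteen (caseA_forrelation_le)
open Summit.QuantumAdvantage.QuantumAdvantage.Theorems.NearExactIsExact.Negative.PfaffianPeriodFourteen (pp_period_pf)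
open Summit.QuantumAdvantage.QuantumAdvantage.Theorems.NearExactIsExact.Negative.TypeTFalseFourteen
  (tf_period_of_min_weight tf_rank_two_card)
open Summit.QuantumAdvantage.QuantumAdvantage.Theorems.NearExactIsExact.Negative.LevelSixSixtyOnePrep (lsp_W_diff_le)
open Summit.QuantumAdvantage.QuantumAdvantage.Theorems.NearExactIsExact.Negative.TypeOOneTwentyOnePrepFourteen
  (to_mod_eight to_cost)
open Summit.QuantumAdvantage.QuantumAdvantage.Theorems.NearExactIsExact.Negative.TypeOFourierCoreFourteen (to_core to_six_freq)
open Summit.QuantumAdvantage.QuantumAdvantage.Theorems.NearExactIsExact.Negative.TypeOBoundaryPrepFourteen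
  (tb_partner_typeO tb_partner_levelSix)

/-! ### The engine: a type-O side with `#E = 2¹⁰` and budget `≤ 28672` is impossible -/

set_option maxHeartbeats 1600000 in
/-- **Engine.**  For cubic `f, g` on 14 bits with `g` of type O (`W_g = 32u`, all `u(x)` odd), budget
`Σ_x (u − 4(−1)^f)² ≤ 28672` (i.e. `Φ ≥ 121/128`) and digit set `E = {d₁ = d₂}` of exactly `2¹⁰` points: contradiction.
(Periods of the minimum-weight word `1_E` kill the Pfaffian of `d₁`; rank 2 is `fo_lowrank_false`; in the radical case the Fourier
core gives `|F̂| ≥ 8192 − 2048 = 6144` at six frequencies, which no cubic partner affords — boundary versions of the partner lemmas.)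
Finite-slice statement; NOT summit progress. [this work] -/
theorem tb_E1024_false (f g : (Fin (7 + 7) → Bool) → Bool) (hf : IsDegLeFun 3 f) (hg : IsDegLeFun 3 g)
    (u : (Fin (7 + 7) → Bool) → ℤ) (hu : ∀ x, W (fun y => signOf (g y)) x = (2 : ℝ) ^ 5 * (u x : ℝ))
    (hodd : ∀ x, Odd (u x)) (hBle : (∑ x, (u x - 4 * sZ (f x)) ^ 2 : ℤ) ≤ 28672)
    (hP1024 : #(univ.filter fun x : Fin (7 + 7) → Bool => decide (Odd (u x / 2) ↔ Odd (u x / 2 / 2)) = true) = 1024) :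
    False := by
  classical
  have hE : ∃ x, (Odd (u x / 2) ↔ Odd (u x / 2 / 2)) := by
    by_contra h
    have h0 : univ.filter (fun x : Fin (7 + 7) → Bool => decide (Odd (u x / 2) ↔ Odd (u x / 2 / 2)) = true) = ∅ :=
      filter_eq_empty_iff.2 fun x _ => by rw [decide_eq_true_iff]; exact fun hx => h ⟨x, hx⟩
    rw [h0, card_empty] at hP1024
    exact absurd hP1024 (by norm_num)
  -- the budget identity; `121/128 ≤ Φ`
  have hbud := fl_budget5 f g u hu
  have hBleR : ((∑ x, (u x - 4 * sZ (f x)) ^ 2 : ℤ) : ℝ) ≤ 28672 := by exact_mod_cast hBle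
  have hbudle : (2 : ℝ) ^ 19 * (1 - forrelation f g) ≤ 28672 := by rw [← hbud]; exact hBleR
  have hΦ : (121 / 128 : ℝ) ≤ forrelation f g := by norm_num at hbudle; linarith
  have hΦ15 : (15 / 16 : ℝ) ≤ forrelation f g := by linarith
  -- digits and the set `E = {d₁ = d₂}`
  have hq : IsDegLeFun 2 (fun x => decide (Odd (u x / 2))) := fd_digitOne g u hg hu
  have hd2 : IsDegLeFun 4 (fun x => decide (Odd (u x / 2 / 2))) := fd_digitTwo g u hg hu
  have he4 : IsDegLeFun (3 + 1) (fun x => decide (Odd (u x / 2) ↔ Odd (u x / 2 / 2))) := by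
    have h := tb_isDegLeFun_xor_const (bb_isDegLeFun_bxor (hq.mono (by norm_num)) hd2) true
    have hfun : (fun x => (decide (Odd (u x / 2)) ^^ decide (Odd (u x / 2 / 2))) ^^ true) =
        (fun x => decide (Odd (u x / 2) ↔ Odd (u x / 2 / 2))) := by
      funext x
      by_cases h1 : Odd (u x / 2) <;> by_cases h2 : Odd (u x / 2 / 2) <;> simp [h1, h2]
    rw [hfun] at h
    exact h
  have hsupp : (univ.filter fun x : Fin (7 + 7) → Bool => decide (Odd (u x / 2) ↔ Odd (u x / 2 / 2)) = true) =
      univ.filter fun x => (Odd (u x / 2) ↔ Odd (u x / 2 / 2)) :=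
    filter_congr fun x _ => by rw [decide_eq_true_iff]
  -- pointwise `F² ≥ 1 + 8·1_E`
  have hsumE : (∑ x, (if (Odd (u x / 2) ↔ Odd (u x / 2 / 2)) then 1 else 0 : ℤ)) =
      #(univ.filter fun x : Fin (7 + 7) → Bool => (Odd (u x / 2) ↔ Odd (u x / 2 / 2))) := by
    rw [sum_boole]
  have hpt : ∀ x, 1 + 8 * (if (Odd (u x / 2) ↔ Odd (u x / 2 / 2)) then 1 else 0 : ℤ) ≤ (u x - 4 * sZ (f x)) ^ 2 :=
    fun x => tw12_pt (u x) (sZ (f x)) (hodd x) (tp_sZ_cases (f x))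
  have hlow : (16384 : ℤ) + 8 * #(univ.filter fun x : Fin (7 + 7) → Bool => (Odd (u x / 2) ↔ Odd (u x / 2 / 2))) ≤
      ∑ x, (u x - 4 * sZ (f x)) ^ 2 := by
    have h := sum_le_sum fun x (_ : x ∈ (univ : Finset (Fin (7 + 7) → Bool))) => hpt x
    rw [sum_add_distrib, ← mul_sum, hsumE, sum_const, card_univ, Fintype.card_fun, Fintype.card_bool,
      Fintype.card_fin] at h
    norm_num at h
    linarith
  have hΦlt1 : forrelation f g < 1 := by
    have h0 : (0 : ℤ) ≤ #(univ.filter fun x : Fin (7 + 7) → Bool => (Odd (u x / 2) ↔ Odd (u x / 2 / 2))) := by positivity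
    have h16 : (16384 : ℤ) ≤ ∑ x, (u x - 4 * sZ (f x)) ^ 2 := by linarith
    have h16R : (16384 : ℝ) ≤ ((∑ x, (u x - 4 * sZ (f x)) ^ 2 : ℤ) : ℝ) := by exact_mod_cast h16
    rw [hbud] at h16R
    norm_num at h16R
    linarith
  -- `#E = 2¹⁰` in both spellings
  have hE1024 : #(univ.filter fun x : Fin (7 + 7) → Bool => (Odd (u x / 2) ↔ Odd (u x / 2 / 2))) = 1024 := by
    rw [← hsupp]; exact hP1024
  have hcardE : 2 ^ (3 + 1) * #(univ.filter fun x : Fin (7 + 7) → Bool =>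
      decide (Odd (u x / 2) ↔ Odd (u x / 2 / 2)) = true) = 2 ^ (7 + 7) := by
    rw [hP1024]; norm_num
  -- every difference of two points of `E` is a period of `1_E`; the mod-8 congruence
  have hper : ∀ a b : Fin (7 + 7) → Bool, decide (Odd (u a / 2) ↔ Odd (u a / 2 / 2)) = true →
      decide (Odd (u b / 2) ↔ Odd (u b / 2 / 2)) = true → ∀ x,
      decide (Odd (u (bxor x (bxor a b)) / 2) ↔ Odd (u (bxor x (bxor a b)) / 2 / 2)) =
        decide (Odd (u x / 2) ↔ Odd (u x / 2 / 2)) :=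
    fun a b ha hb => tf_period_of_min_weight (fun x => decide (Odd (u x / 2) ↔ Odd (u x / 2 / 2))) he4 hcardE a b ha hb
  have hmod : ∀ x, (8 : ℤ) ∣ u x - 5 + 2 * (if decide (Odd (u x / 2)) = true then 1 else 0 : ℤ) +
      4 * (if decide (Odd (u x / 2) ↔ Odd (u x / 2 / 2)) = true then 1 else 0 : ℤ) :=
    fun x => to_mod_eight (u x) (hodd x)
  by_cases hrad : ∀ a b : Fin (7 + 7) → Bool, decide (Odd (u a / 2) ↔ Odd (u a / 2 / 2)) = true →
      decide (Odd (u b / 2) ↔ Odd (u b / 2 / 2)) = true →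
      ∀ y, (decide (Odd (u zeroVec / 2)) ^^ decide (Odd (u (bxor a b) / 2)) ^^ decide (Odd (u y / 2)) ^^
        decide (Odd (u (bxor (bxor a b) y) / 2))) = false
  · -- RADICAL CASE: the Fourier core and the six large frequencies
    have hR : ¬ 2 ^ 12 ≤ #(univ.filter fun x : Fin (7 + 7) → Bool => ∀ y, (decide (Odd (u zeroVec / 2)) ^^
        decide (Odd (u x / 2)) ^^ decide (Odd (u y / 2)) ^^ decide (Odd (u (bxor x y) / 2))) = false) :=
      fun h => fo_lowrank_false f g hg u hu hodd h hE hΦ15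
    have hvals := to_core (fun z => decide (Odd (u z / 2))) (fun z => decide (Odd (u z / 2) ↔ Odd (u z / 2 / 2)))
      hq hP1024 hrad hR
    -- the mod-8 representative `T = F₀` of the residual, as an integer function
    obtain ⟨T, hT⟩ : ∃ T : (Fin (7 + 7) → Bool) → ℤ, ∀ x, T x = (1 - 2 * (if Odd (u x / 2) then 1 else 0 : ℤ)) *
        (1 - 4 * (if (Odd (u x / 2) ↔ Odd (u x / 2 / 2)) then 1 else 0 : ℤ)) := ⟨_, fun x => rfl⟩
    have hfun : (fun x => ((T x : ℤ) : ℝ)) = fun x => signOf (decide (Odd (u x / 2))) *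
        (1 - 4 * (if decide (Odd (u x / 2) ↔ Odd (u x / 2 / 2)) = true then (1 : ℝ) else 0)) := by
      funext x
      rw [hT x]
      by_cases h1 : Odd (u x / 2) <;> by_cases h2 : Odd (u x / 2 / 2) <;> norm_num [h1, h2, signOf]
    have hvalsT : ∀ y, W (fun x => ((T x : ℤ) : ℝ)) y = 0 ∨ W (fun x => ((T x : ℤ) : ℝ)) y = 8192 ∨
        W (fun x => ((T x : ℤ) : ℝ)) y = -8192 := by
      intro y; rw [hfun]; exact hvals y
    have hcostpt : ∀ x, T x ^ 2 + 2 * |(u x - 4 * sZ (f x)) - T x| ≤ (u x - 4 * sZ (f x)) ^ 2 ∧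
        T x ^ 2 = 1 + 8 * (if (Odd (u x / 2) ↔ Odd (u x / 2 / 2)) then 1 else 0 : ℤ) := by
      intro x
      have h := to_cost (u x) (sZ (f x)) (hodd x) (tp_sZ_cases (f x))
      rw [hT x]
      exact ⟨h.2, h.1⟩
    have hTsq : ∑ x, T x ^ 2 = 24576 := by
      rw [sum_congr rfl fun x _ => (hcostpt x).2, sum_add_distrib, ← mul_sum, hsumE, hE1024, sum_const, card_univ,
        Fintype.card_fun, Fintype.card_bool, Fintype.card_fin]
      norm_num
    have hl1 : (∑ x, |(u x - 4 * sZ (f x)) - T x| : ℤ) ≤ 2048 := by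
      have h := sum_le_sum fun x (_ : x ∈ (univ : Finset (Fin (7 + 7) → Bool))) => (hcostpt x).1
      rw [sum_add_distrib, ← mul_sum, hTsq] at h
      omega
    have hParsT : ∑ y, W (fun x => ((T x : ℤ) : ℝ)) y ^ 2 = (2 : ℝ) ^ (7 + 7) * 24576 := by
      rw [sum_W_sq]
      congr 1
      have h : ∑ x, ((T x : ℤ) : ℝ) ^ 2 = ((∑ x, T x ^ 2 : ℤ) : ℝ) := by push_cast; rfl
      rw [h, hTsq]
      norm_num
    have hsix := to_six_freq _ hvalsT hParsT
    have hbig : ∀ y ∈ univ.filter (fun y => W (fun x => ((T x : ℤ) : ℝ)) y ≠ 0),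
        (6144 : ℝ) ≤ |W (fun x => ((u x - 4 * sZ (f x) : ℤ) : ℝ)) y| := by
      intro y hy
      have hy' := (mem_filter.1 hy).2
      have h8 : |W (fun x => ((T x : ℤ) : ℝ)) y| = 8192 := by
        rcases hvalsT y with h | h | h
        · exact absurd h hy'
        · rw [h]; norm_num
        · rw [h]; norm_num
      have hdiff : |W (fun x => ((u x - 4 * sZ (f x) : ℤ) : ℝ)) y - W (fun x => ((T x : ℤ) : ℝ)) y| ≤
          ((∑ x, |(u x - 4 * sZ (f x)) - T x| : ℤ) : ℝ) := lsp_W_diff_le (fun x => u x - 4 * sZ (f x)) T y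
      have hl1R : ((∑ x, |(u x - 4 * sZ (f x)) - T x| : ℤ) : ℝ) ≤ 2048 := by exact_mod_cast hl1
      have htri := abs_sub_abs_le_abs_sub (W (fun x => ((T x : ℤ) : ℝ)) y) (W (fun x => ((u x - 4 * sZ (f x) : ℤ) : ℝ)) y)
      rw [abs_sub_comm] at htri
      linarith
    -- partner dispatch on the cubic `f`
    obtain ⟨v, hv⟩ := tw_base f hf 5 (by norm_num)
    by_cases hvodd : ∀ y, Odd (v y)
    · have hbud' : ((∑ y, (v y - 4 * sZ (g y)) ^ 2 : ℤ) : ℝ) = (2 : ℝ) ^ 19 * (1 - forrelation f g) := by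
        rw [forrelation_comm]; exact fl_budget5 g f v hv
      have hB' : (∑ y, (v y - 4 * sZ (g y)) ^ 2 : ℤ) ≤ 28672 := by
        have h : ((∑ y, (v y - 4 * sZ (g y)) ^ 2 : ℤ) : ℝ) ≤ 28672 := by rw [hbud']; exact hbudle
        exact_mod_cast h
      exact tb_partner_typeO f g u hu v hv hvodd _ hsix hbig hB'
    · push Not at hvodd
      obtain ⟨y₀, hy₀⟩ := hvodd
      have hev : ∀ y, ¬ Odd (v y) := fun y h => hy₀ ((fd_parity_const f v hf hv y y₀).1 h)
      have hv6 := tw_level_up f v hv hev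
      by_cases h6 : ∃ y, Odd (v y / 2)
      · have hbud6 : ((∑ y, (v y / 2 - 2 * sZ (g y)) ^ 2 : ℤ) : ℝ) = (2 : ℝ) ^ 17 * (1 - forrelation f g) := by
          rw [forrelation_comm]; exact fl_budget6 g f (fun y => v y / 2) hv6
        have hB6 : (∑ y, (v y / 2 - 2 * sZ (g y)) ^ 2 : ℤ) ≤ 7168 := by
          have h : ((∑ y, (v y / 2 - 2 * sZ (g y)) ^ 2 : ℤ) : ℝ) ≤ 7168 := by
            rw [hbud6]; norm_num at hbudle ⊢; linarith
          exact_mod_cast h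
        exact tb_partner_levelSix f g hf u hu (fun y => v y / 2) hv6 h6 _ hsix hbig hB6
      · push Not at h6
        have hv7 := tw_level_up f (fun y => v y / 2) hv6 h6
        have hΦ15' : (15 / 16 : ℝ) ≤ forrelation g f := by rw [forrelation_comm]; exact hΦ15
        rcases fo_levelSeven g f hg hf _ hv7 hΦ15' with h | h
        · rw [forrelation_comm] at h
          exact absurd h (ne_of_lt hΦlt1)
        · rw [forrelation_comm] at h
          linarith [h.2]
  · -- RANK-2 CASE: a difference outside the radical
    push Not at hrad
    obtain ⟨a, b, ha', hb', a', ha'ne⟩ := hrad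
    have hBat : (decide (Odd (u zeroVec / 2)) ^^ decide (Odd (u a' / 2)) ^^ decide (Odd (u (bxor a b) / 2)) ^^
        decide (Odd (u (bxor a' (bxor a b)) / 2))) = true := by
      rw [es_B_symm (fun z => decide (Odd (u z / 2))) a' (bxor a b)]
      revert ha'ne
      cases (decide (Odd (u zeroVec / 2)) ^^ decide (Odd (u (bxor a b) / 2)) ^^ decide (Odd (u a' / 2)) ^^
        decide (Odd (u (bxor (bxor a b) a') / 2))) <;> simp
    have hPf := fun b' c' => pp_period_pf g hg u hu (fun z => decide (Odd (u z / 2)))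
      (fun z => decide (Odd (u z / 2) ↔ Odd (u z / 2 / 2))) hq hmod (bxor a b) (hper a b ha' hb') a' b' c'
    have hK := tf_rank_two_card (fun z => decide (Odd (u z / 2))) hq (bxor a b) a' hBat hPf
    have hrad12 : 2 ^ 12 ≤ #(univ.filter fun x : Fin (7 + 7) → Bool => ∀ y, (decide (Odd (u zeroVec / 2)) ^^
        decide (Odd (u x / 2)) ^^ decide (Odd (u y / 2)) ^^ decide (Odd (u (bxor x y) / 2))) = false) := by
      norm_num at hK ⊢
      omega
    exact fo_lowrank_false f g hg u hu hodd hrad12 hE hΦ15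


/-! ### The shape of a type-O side at `Φ ≥ 121/128` -/

/-- **THEOREM TypeO121-boundary.**  For cubic `f, g` on 14 bits with `g` of type O (`W_g = 32u`, all `u(x)` odd) and
`121/128 ≤ Φ(f,g)`: the digit set `E = {d₁ = d₂}` has exactly `1536 = 1.5·2¹⁰` points (the second weight of `RM(4,14)`), the
residual is TIGHT — `(u − 4(−1)^f)² = 1 + 8·1_E` pointwise, i.e. `u − 4(−1)^f ∈ {±1}` off `E` and `∈ {±3}` on `E` — and
`Φ(f,g) = 121/128` exactly.  (`E = ∅` is case A, `≤ 59/64`; `#E ≤ 1536` by the budget; `#E < 1536` forces `#E = 2¹⁰`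
(`sw_second_weight_all`), excluded by the engine `tb_E1024_false`; `#E = 1536` exhausts the budget.)  So `121/128` is a value of a
cubic pair with a type-O side on 14 bits only through this rigid configuration.  Finite-slice statement; NOT summit progress. [this work] -/
theorem typeO_ge_121_shape (f g : (Fin (7 + 7) → Bool) → Bool) (hf : IsDegLeFun 3 f) (hg : IsDegLeFun 3 g)
    (u : (Fin (7 + 7) → Bool) → ℤ) (hu : ∀ x, W (fun y => signOf (g y)) x = (2 : ℝ) ^ 5 * (u x : ℝ))
    (hodd : ∀ x, Odd (u x)) (hΦ : (121 / 128 : ℝ) ≤ forrelation f g) :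
    #(univ.filter fun x : Fin (7 + 7) → Bool => (Odd (u x / 2) ↔ Odd (u x / 2 / 2))) = 1536 ∧
    (∀ x, (u x - 4 * sZ (f x)) ^ 2 = 1 + 8 * (if (Odd (u x / 2) ↔ Odd (u x / 2 / 2)) then 1 else 0 : ℤ)) ∧
    forrelation f g = 121 / 128 := by
  classical
  have hbud := fl_budget5 f g u hu
  have hBle : (∑ x, (u x - 4 * sZ (f x)) ^ 2 : ℤ) ≤ 28672 := by
    have h : ((∑ x, (u x - 4 * sZ (f x)) ^ 2 : ℤ) : ℝ) ≤ 28672 := by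
      rw [hbud]; norm_num at hΦ ⊢; linarith
    exact_mod_cast h
  have hE : ∃ x, (Odd (u x / 2) ↔ Odd (u x / 2 / 2)) := by
    by_contra h
    have hA := caseA_forrelation_le f g hf hg u hu hodd fun x hx => h ⟨x, hx⟩
    linarith
  have hq : IsDegLeFun 2 (fun x => decide (Odd (u x / 2))) := fd_digitOne g u hg hu
  have hd2 : IsDegLeFun 4 (fun x => decide (Odd (u x / 2 / 2))) := fd_digitTwo g u hg hu
  have he4 : IsDegLeFun (3 + 1) (fun x => decide (Odd (u x / 2) ↔ Odd (u x / 2 / 2))) := by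
    have h := tb_isDegLeFun_xor_const (bb_isDegLeFun_bxor (hq.mono (by norm_num)) hd2) true
    have hfun : (fun x => (decide (Odd (u x / 2)) ^^ decide (Odd (u x / 2 / 2))) ^^ true) =
        (fun x => decide (Odd (u x / 2) ↔ Odd (u x / 2 / 2))) := by
      funext x
      by_cases h1 : Odd (u x / 2) <;> by_cases h2 : Odd (u x / 2 / 2) <;> simp [h1, h2]
    rw [hfun] at h
    exact h
  have hsupp : (univ.filter fun x : Fin (7 + 7) → Bool => decide (Odd (u x / 2) ↔ Odd (u x / 2 / 2)) = true) =
      univ.filter fun x => (Odd (u x / 2) ↔ Odd (u x / 2 / 2)) :=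
    filter_congr fun x _ => by rw [decide_eq_true_iff]
  have hsumE : (∑ x, (if (Odd (u x / 2) ↔ Odd (u x / 2 / 2)) then 1 else 0 : ℤ)) =
      #(univ.filter fun x : Fin (7 + 7) → Bool => (Odd (u x / 2) ↔ Odd (u x / 2 / 2))) := by
    rw [sum_boole]
  have hpt : ∀ x, 1 + 8 * (if (Odd (u x / 2) ↔ Odd (u x / 2 / 2)) then 1 else 0 : ℤ) ≤ (u x - 4 * sZ (f x)) ^ 2 :=
    fun x => tw12_pt (u x) (sZ (f x)) (hodd x) (tp_sZ_cases (f x))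
  have hlow : (16384 : ℤ) + 8 * #(univ.filter fun x : Fin (7 + 7) → Bool => (Odd (u x / 2) ↔ Odd (u x / 2 / 2))) ≤
      ∑ x, (u x - 4 * sZ (f x)) ^ 2 := by
    have h := sum_le_sum fun x (_ : x ∈ (univ : Finset (Fin (7 + 7) → Bool))) => hpt x
    rw [sum_add_distrib, ← mul_sum, hsumE, sum_const, card_univ, Fintype.card_fun, Fintype.card_bool,
      Fintype.card_fin] at h
    norm_num at h
    linarith
  have hEle : #(univ.filter fun x : Fin (7 + 7) → Bool => (Odd (u x / 2) ↔ Odd (u x / 2 / 2))) ≤ 1536 := by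
    have h := hlow.trans hBle
    omega
  have hne : ∃ x, decide (Odd (u x / 2) ↔ Odd (u x / 2 / 2)) = true := by
    obtain ⟨x, hx⟩ := hE
    exact ⟨x, decide_eq_true hx⟩
  by_cases h1536 : 2 ^ (4 + 1) * #(univ.filter fun x : Fin (7 + 7) → Bool =>
      decide (Odd (u x / 2) ↔ Odd (u x / 2 / 2)) = true) < 3 * 2 ^ (7 + 7)
  · -- `#E < 1536` ⇒ `#E = 2¹⁰` ⇒ the engine
    exfalso
    have h := sw_second_weight_all 4 (by norm_num) (7 + 7) _ he4 hne h1536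
    have h16 : (2 : ℕ) ^ 4 = 16 := by norm_num
    have h14 : (2 : ℕ) ^ (7 + 7) = 16384 := by norm_num
    rw [h16, h14] at h
    have hP1024 : #(univ.filter fun x : Fin (7 + 7) → Bool =>
        decide (Odd (u x / 2) ↔ Odd (u x / 2 / 2)) = true) = 1024 := by omega
    exact tb_E1024_false f g hf hg u hu hodd hBle hP1024
  · -- `#E = 1536`: the budget is exhausted
    rw [hsupp] at h1536
    push Not at h1536
    have hE1536 : #(univ.filter fun x : Fin (7 + 7) → Bool => (Odd (u x / 2) ↔ Odd (u x / 2 / 2))) = 1536 := by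
      norm_num at h1536
      omega
    have hBeq : (∑ x, (u x - 4 * sZ (f x)) ^ 2 : ℤ) = 28672 := by
      have h : (#(univ.filter fun x : Fin (7 + 7) → Bool => (Odd (u x / 2) ↔ Odd (u x / 2 / 2))) : ℤ) = 1536 := by
        exact_mod_cast hE1536
      rw [h] at hlow
      linarith
    refine ⟨hE1536, ?_, ?_⟩
    · have hsum0 : ∑ x, ((u x - 4 * sZ (f x)) ^ 2 -
          (1 + 8 * (if (Odd (u x / 2) ↔ Odd (u x / 2 / 2)) then 1 else 0 : ℤ))) = 0 := by
        rw [sum_sub_distrib, sum_add_distrib, ← mul_sum, hsumE, hE1536, hBeq, sum_const, card_univ, Fintype.card_fun,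
          Fintype.card_bool, Fintype.card_fin]
        norm_num
      have hnn : ∀ x ∈ (univ : Finset (Fin (7 + 7) → Bool)), (0 : ℤ) ≤ (u x - 4 * sZ (f x)) ^ 2 -
          (1 + 8 * (if (Odd (u x / 2) ↔ Odd (u x / 2 / 2)) then 1 else 0 : ℤ)) := fun x _ => by linarith [hpt x]
      have h0 := (sum_eq_zero_iff_of_nonneg hnn).1 hsum0
      intro x
      linarith [h0 x (mem_univ x)]
    · have h : ((∑ x, (u x - 4 * sZ (f x)) ^ 2 : ℤ) : ℝ) = 28672 := by exact_mod_cast hBeq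
      rw [hbud] at h
      norm_num at h ⊢
      linarith

/-- **Corollary.**  A cubic pair on 14 bits with a type-O side whose digit set `{d₁ = d₂}` does not have exactly `1536` points
has `Φ < 121/128`.  NOT summit progress. [this work] -/
theorem typeO_lt_121_of_card_ne (f g : (Fin (7 + 7) → Bool) → Bool) (hf : IsDegLeFun 3 f) (hg : IsDegLeFun 3 g)
    (u : (Fin (7 + 7) → Bool) → ℤ) (hu : ∀ x, W (fun y => signOf (g y)) x = (2 : ℝ) ^ 5 * (u x : ℝ))
    (hodd : ∀ x, Odd (u x))
    (hne : #(univ.filter fun x : Fin (7 + 7) → Bool => (Odd (u x / 2) ↔ Odd (u x / 2 / 2))) ≠ 1536) :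
    forrelation f g < 121 / 128 := by
  by_contra h
  push Not at h
  exact hne (typeO_ge_121_shape f g hf hg u hu hodd h).1

end Summit.QuantumAdvantage.QuantumAdvantage.Theorems.NearExactIsExact.Negative.TypeOBoundaryOneTwentyOneFourteen

end
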